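import Literature.AlgebraicGeometry.Motives.AbelianVarietyWeilPairingRosatiTransport
import HarnessLib

/-!
# The radical bound `Q^{ℓ^{#K(X)}} = 1` for the level-`ℓᵏ` Weil pairings of an ample divisor, for EVERY `ℓ > 1`

Topic `Literature/AlgebraicGeometry/Motives`, namespace `Literature.AlgebraicGeometry.Motives`.  Sequel of
`AbelianVarietyWeilPairingRadical` (`pow_prime_pow_eq_one_of_pow_eq_one`, `AbelianVariety.pow_prime_pow_natCard_KTheta_eq_one`)
and `AbelianVarietyWeilPairingRosatiTransport` §3 (`AbelianVariety.weilPairingLevel_radical_pow_card_KTheta`, `ℓ` PRIME):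
the same statements with «`ℓ` prime» weakened to «`1 < ℓ`» — the «composite-`ℓ` bookkeeping» of the cell `hodgecm-mathlib`'s row
II-1-S5b (the (nd) clause `∃ c, ∀ k Q, (∀ P, ē^X_{ℓᵏ}(P, Q) = 1) → Q^{ℓ^c} = 1` of `exists_balancedDivisor_finiteExtension` is
quantified over all `ℓ > 1`).  PROVED here (theorems only; no definition, no named fact):

* `pow_pow_eq_one_of_pow_eq_one` — in any monoid, `x^{ℓᵏ} = 1` and `x^m = 1` with `m > 0`, `ℓ > 1` give `x^{ℓ^m} = 1`:
  the order `d` of `x` divides `ℓᵏ` and `m`; every prime of `d` divides `ℓ`, with multiplicity `< d ≤ m`, so `d ∣ ℓ^m`;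
* `AbelianVariety.pow_pow_natCard_KTheta_eq_one` — an `ℓ`-power-torsion point of the finite group `K(Θ)` (`Θ` ample) is
  killed by `ℓ^{#K(Θ)}`;
* **`AbelianVariety.weilPairingLevel_radical_pow_card_KTheta_of_one_lt`** — over an algebraically closed field in which
  `ℓ ≠ 0`, for `X` ample: if `ē^X_{ℓᵏ}(P, Q) = 1` for all `P ∈ A[ℓᵏ]` then `Q^{ℓ^{#K(X)}} = 1` (Lang VII §2 Prop. 4 puts `Q`
  in `K(X)`, exactly as in the prime case; only the last group-theoretic step changes).  The exponent `c = #K(X)` is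
  uniform in `k`, the shape `hrad` of `mul_complexConj_eq_one_of_weilPairingLevel_eq`.

## References

* [Lang1983AbelianVarieties] S. Lang, *Abelian Varieties*, Ch. VII §2 Prop. 4.
* [MumfordAV1970] D. Mumford, *Abelian Varieties* (1970), §6 Application 1 (p. 60), §20 (pp. 183–186).
-/

universe u

open CategoryTheory CategoryTheory.Limits AlgebraicGeometry

noncomputable section

namespace Literature.AlgebraicGeometry.Motives

/-- In a monoid, an element killed by a power `ℓᵏ` (`ℓ > 1`) and by some `m > 0` is killed by `ℓ^m`: its order `d`
divides `ℓᵏ` and `m`, so every prime factor `p` of `d` divides `ℓ` and `p^{v_p(d)} ≤ d ≤ m < … ` gives `v_p(d) < d ≤ m ≤ m · v_p(ℓ)`,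
whence `d ∣ ℓ^m`.  (The prime case is `pow_prime_pow_eq_one_of_pow_eq_one`.) [cite: Lang1983AbelianVarieties, Ch. VII §2 Prop. 4] -/
theorem pow_pow_eq_one_of_pow_eq_one {G : Type*} [Monoid G] {x : G} {ℓ k m : ℕ} (hℓ : 1 < ℓ) (hm : 0 < m)
    (hk : x ^ ℓ ^ k = 1) (hxm : x ^ m = 1) : x ^ ℓ ^ m = 1 := by
  have hℓ0 : ℓ ≠ 0 := by omega
  have h1 : orderOf x ∣ ℓ ^ k := orderOf_dvd_of_pow_eq_one hk
  have h2 : orderOf x ∣ m := orderOf_dvd_of_pow_eq_one hxm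
  have hd0 : orderOf x ≠ 0 := fun h => by
    rw [h, zero_dvd_iff] at h2
    omega
  have hdm : orderOf x ≤ m := Nat.le_of_dvd hm h2
  -- `orderOf x ∣ ℓ ^ m`, prime by prime
  have hdvd : orderOf x ∣ ℓ ^ m := by
    rw [← Nat.factorization_le_iff_dvd hd0 (pow_ne_zero m hℓ0), Nat.factorization_pow]
    intro p
    rw [Finsupp.smul_apply, smul_eq_mul]
    by_cases hp : p ∈ (orderOf x).factorization.support
    · -- `p ∣ orderOf x ∣ ℓ ^ k`, so `p ∣ ℓ` and `1 ≤ v_p(ℓ)`; and `v_p(orderOf x) < orderOf x ≤ m`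
      rw [Nat.support_factorization] at hp
      have hpp : p.Prime := Nat.prime_of_mem_primeFactors hp
      have hpℓ : p ∣ ℓ := hpp.dvd_of_dvd_pow ((Nat.dvd_of_mem_primeFactors hp).trans h1)
      have h1ℓ : 1 ≤ ℓ.factorization p := by
        rw [Nat.succ_le_iff, Nat.pos_iff_ne_zero]
        exact fun h => ((Nat.factorization_eq_zero_iff ℓ p).1 h).elim (fun h' => h' hpp)
          (fun h' => h'.elim (fun h'' => h'' hpℓ) (fun h'' => hℓ0 h''))
      have hlt : (orderOf x).factorization p < orderOf x := Nat.factorization_lt p hd0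
      calc (orderOf x).factorization p ≤ m := by omega
        _ ≤ m * ℓ.factorization p := Nat.le_mul_of_pos_right m h1ℓ
    · rw [Finsupp.notMem_support_iff.mp hp]
      exact Nat.zero_le _
  obtain ⟨c, hc⟩ := hdvd
  rw [hc, pow_mul, pow_orderOf_eq_one, one_pow]

namespace AbelianVariety

/-! ## `ℓ`-power torsion in `K(Θ)` -/

section KTheta

variable {K : Type u} [Field K] (A : AbelianVariety K)

/-- An `ℓ`-power-torsion point of `K(Θ)` (`Θ` ample, so `K(Θ)` is finite — Mumford §6 Application 1,
`finite_KTheta`) is killed by `ℓ^{#K(Θ)}`, for every `ℓ > 1` (composite allowed; the prime case is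
`pow_prime_pow_natCard_KTheta_eq_one`). [cite: MumfordAV1970, §6 Application 1 (p. 60)] -/
theorem pow_pow_natCard_KTheta_eq_one [IsAlgClosed K] {Θ : CartierDivisor A.X.left}
    (hΘ : Θ.IsAmple) {ℓ : ℕ} (hℓ : 1 < ℓ) {k : ℕ} {P : A.Points K} (hk : P ^ ℓ ^ k = 1)
    (hP : P ∈ A.KTheta Θ) : P ^ ℓ ^ Nat.card (A.KTheta Θ) = 1 :=
  pow_pow_eq_one_of_pow_eq_one hℓ (A.natCard_KTheta_pos hΘ) hk (A.pow_natCard_KTheta_eq_one hP)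

end KTheta

/-! ## The radical bound for every `ℓ > 1` -/

section Radical

variable {L : Type u} [Field L] [IsAlgClosed L] (A : AbelianVariety L)

/-- **The radical of `ē_{ℓᵏ}^X` in the second variable is killed by `ℓ^{#K(X)}`**, for `X` ample and ANY `ℓ > 1`
invertible in the algebraically closed ground field: if `ē_{ℓᵏ}^X(P, Q) = 1` for every `P ∈ A[ℓᵏ](L)` then `t_Q^* X ∼ X`,
i.e. `Q ∈ K(X)` (Lang VII §2 Prop. 4, the tree's `weilDiv_linEquiv_zero_of_forall_weilPairingLevel_eq_one`; Kummer
hypotheses: `[ℓᵏ]` is an isogeny — `isIsogeny_zsmul_id_holds` —, flat — `IsIsogeny.flat_toSchemeHom_holds` —, of degree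
`#A[ℓᵏ](L)` — `natCard_torsionPoints_eq_of_isAlgClosed`, `kerRank_zsmul_id_holds`), and the `ℓ`-power-torsion point `Q` of
the finite group `K(X)` satisfies `Q^{ℓ^{#K(X)}} = 1` (`pow_pow_natCard_KTheta_eq_one`).  The exponent `c = #K(X)` is uniform in
`k`: this is the (nd) clause of the cell `hodgecm-mathlib`'s row II-1-S5b for every `ℓ > 1` (the prime case is
`weilPairingLevel_radical_pow_card_KTheta`). [cite: Lang1983AbelianVarieties, Ch. VII §2 Prop. 4]
[cite: MumfordAV1970, §6 Application 1 (p. 60), §20 (pp. 183–186)] -/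
theorem weilPairingLevel_radical_pow_card_KTheta_of_one_lt {X : CartierDivisor A.X.left} (hX : X.IsAmple)
    {ℓ : ℕ} (hℓ : 1 < ℓ) (hℓL : (ℓ : L) ≠ 0) (k : ℕ)
    [IsDominant (Hom.toSchemeHom (((ℓ ^ k : ℕ) : ℤ) • 𝟙 A))]
    (Q : A.torsionPoints L ((ℓ ^ k : ℕ) : ℤ))
    (h : ∀ P : A.torsionPoints L ((ℓ ^ k : ℕ) : ℤ), A.weilPairingLevel X P Q = 1) :
    (Q : A.Points L) ^ (ℓ ^ Nat.card (A.KTheta X)) = 1 := by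
  have hℓ0 : ℓ ≠ 0 := by omega
  have hN0 : (ℓ ^ k : ℕ) ≠ 0 := pow_ne_zero k hℓ0
  have hNZ : ((ℓ ^ k : ℕ) : ℤ) ≠ 0 := Int.natCast_ne_zero.mpr hN0
  have hNL : (((ℓ ^ k : ℕ) : ℤ) : L) ≠ 0 := by
    rw [Int.cast_natCast, Nat.cast_pow]
    exact pow_ne_zero k hℓL
  -- the Kummer-theory hypotheses on `[ℓ^k]_A`
  have hiso : IsIsogeny (((ℓ ^ k : ℕ) : ℤ) • 𝟙 A) := isIsogeny_zsmul_id_holds A _ hNZ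
  haveI : Surjective (Hom.toSchemeHom (((ℓ ^ k : ℕ) : ℤ) • 𝟙 A)) := hiso.1
  haveI : IsFinite (Hom.toSchemeHom (((ℓ ^ k : ℕ) : ℤ) • 𝟙 A)) := hiso.2
  haveI : Flat (Hom.toSchemeHom (((ℓ ^ k : ℕ) : ℤ) • 𝟙 A)) := IsIsogeny.flat_toSchemeHom_holds hiso
  have hcard : Nat.card (A.torsionPoints L ((ℓ ^ k : ℕ) : ℤ)) =
      (((ℓ ^ k : ℕ)) : ℤ).natAbs ^ (2 * A.dim) :=
    natCard_torsionPoints_eq_of_isAlgClosed A L _ hNL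
  haveI : Finite (A.torsionPoints L ((ℓ ^ k : ℕ) : ℤ)) :=
    Nat.finite_of_card_ne_zero (by
      rw [hcard, Int.natAbs_natCast]
      exact pow_ne_zero _ hN0)
  have hdeg : Module.finrank A.X.left.functionField
      (FunctionFieldOver (Hom.toSchemeHom (((ℓ ^ k : ℕ) : ℤ) • 𝟙 A))) =
        Nat.card (A.torsionPoints L ((ℓ ^ k : ℕ) : ℤ)) := by
    rw [← hiso.kerRank_eq_finrank_functionFieldOver, kerRank_zsmul_id_holds A _ hNZ, hcard]
  -- Lang VII §2 Prop. 4: `Q ∈ K(X)`; then `K(X)` finite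
  have hKT : (Q : A.Points L) ∈ A.KTheta X :=
    (A.mem_KTheta_iff X _).2
      (weilDiv_linEquiv_zero_of_forall_weilPairingLevel_eq_one (Nat.pos_of_ne_zero hN0) hdeg X Q h)
  have hQk : (Q : A.Points L) ^ ℓ ^ k = 1 := by
    have hQ := (mem_torsionPoints_iff _ _).1 Q.2
    rwa [zpow_natCast] at hQ
  exact A.pow_pow_natCard_KTheta_eq_one hX hℓ hQk hKT

/-- The (nd) clause in the SHAPE of row II-1-S5b / `mul_complexConj_eq_one_of_weilPairingLevel_eq`'s `hrad`: for `X` ample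
and `ℓ > 1` invertible in `L`, ONE exponent `c` (namely `#K(X)`) kills every `Q ∈ A[ℓᵏ]` in the radical of `ē^X_{ℓᵏ}`, for
all `k` at once. [cite: Lang1983AbelianVarieties, Ch. VII §2 Prop. 4] [cite: MumfordAV1970, §6 Application 1 (p. 60)] -/
theorem exists_radical_pow_eq_one_of_isAmple {X : CartierDivisor A.X.left} (hX : X.IsAmple)
    {ℓ : ℕ} (hℓ : 1 < ℓ) (hℓL : (ℓ : L) ≠ 0)
    [∀ k : ℕ, IsDominant (Hom.toSchemeHom (((ℓ ^ k : ℕ) : ℤ) • 𝟙 A))] :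
    ∃ c : ℕ, ∀ (k : ℕ) (Q : A.torsionPoints L ((ℓ ^ k : ℕ) : ℤ)),
      (∀ P : A.torsionPoints L ((ℓ ^ k : ℕ) : ℤ), A.weilPairingLevel X P Q = 1) →
        (Q : A.Points L) ^ (ℓ ^ c) = 1 :=
  ⟨Nat.card (A.KTheta X), fun k Q hQ => A.weilPairingLevel_radical_pow_card_KTheta_of_one_lt hX hℓ hℓL k Q hQ⟩

end Radical

end AbelianVariety

end Literature.AlgebraicGeometry.Motives

end
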